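import Mathlib
import Summits.MatrixMultiplication.MatrixMultiplication.Theorems.SoloBlindFlatNeeds
import Summits.MatrixMultiplication.MatrixMultiplication.Theorems.SoloBlindFlatGreedy
import Summits.MatrixMultiplication.MatrixMultiplication.Theorems.SoloBlindFlatCheckSound

/-!
# The K♭ / E♭ checker: the configuration realises the pattern model

In the setting of `SoloBlindFlatNeeds` (linearly independent, subset-sum-distinct block `B`; letters
`x : Fin m ↪ ι` avoiding `B`; target `τ`; exact family `F`; type codes `t_i` of block indices) we
define the VISIBLE block indices, their PATTERNS, the FIBRES and MULTIPLICITIES of the checker's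
patterns and the set `J` of ACTIVE pattern indices, and prove:

* `J` is valid for the checker's killer masks (`soloBlind_validSem_jAct`, from NEEDS ARE MET);
* the block exponents of the pattern model undercount the true ones, hence
  `K(τ; B ∪ X) ≤ patMass(J, multiplicities)` (`soloBlind_mass_le_patMass`);
* `∑_{j ∈ J} mult_j = #visible = |core ∩ B|` and `|core| = |core ∩ B| + m` when all letters are used;
* the `d`-certificate bounds the rank: `coreRank + d ≤ |core ∩ B| + m` (`soloBlind_coreRank_add_flatD_le`).

The final assembly (checker verdict ⟹ K♭ / E♭ for the configuration) is `SoloBlindFlatSound`.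
-/

namespace Summit.MatrixMultiplication.MatrixMultiplication.Theorems

open Finset Module

variable {G : Type*} [AddCommGroup G] [DecidableEq G] [Module (ZMod 3) G] {ι : Type*} [DecidableEq ι]

section Data

variable {h : ι → G} {B : Finset ι} (hli : LinearIndependent (ZMod 3) (fun i : B => h i))
  {m : ℕ} (x : Fin m ↪ ι) (τ : G)

/-- Visibility of the block index `i` (for the exact family of `τ`). -/
noncomputable def soloBlindVisB (i : B) : Bool :=
  soloBlindVisible (soloBlindMkFlatTabs m) m (soloBlindExactFam h B x τ) (soloBlindTyc hli x τ (Sum.inl i))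

/-- The pattern of the block index `i`. -/
noncomputable def soloBlindPatB (i : B) : ℕ :=
  soloBlindPatOf (soloBlindMkFlatTabs m) m (soloBlindExactFam h B x τ) (soloBlindTyc hli x τ (Sum.inl i))

/-- The fibre of the `j`-th pattern of the checker: the visible block indices with that pattern. -/
noncomputable def soloBlindPatFib (j : ℕ) : Finset B :=
  Finset.univ.filter fun i : B => soloBlindVisB hli x τ i = true ∧ soloBlindPatB hli x τ i =
    (soloBlindPats (soloBlindMkFlatTabs m) m (soloBlindExactFam h B x τ)).getD j 0

/-- The multiplicity of the `j`-th pattern. -/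
noncomputable def soloBlindPatMult (j : ℕ) : ℕ := (soloBlindPatFib hli x τ j).card

/-- The active pattern indices: those of positive multiplicity. -/
noncomputable def soloBlindJAct : Finset ℕ :=
  (Finset.range (soloBlindPats (soloBlindMkFlatTabs m) m (soloBlindExactFam h B x τ)).length).filter
    fun j => 0 < soloBlindPatMult hli x τ j

end Data

/-- An in-range default read is a member. -/
private theorem soloBlind_getD_mem {l : List ℕ} {k : ℕ} (hk : k < l.length) : l.getD k 0 ∈ l := by
  rw [List.getD_eq_getElem _ _ hk]
  exact List.getElem_mem hk

/-- The pattern list of the checker has no duplicates. -/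
theorem soloBlind_pats_nodup (T : SoloBlindFlatTabs) (m : ℕ) (F : List ℕ) : (soloBlindPats T m F).Nodup := by
  unfold soloBlindPats
  exact List.nodup_dedup _

section Model

variable {h : ι → G} {B : Finset ι} (hli : LinearIndependent (ZMod 3) (fun i : B => h i))
  {m : ℕ} (x : Fin m ↪ ι) (τ : G)

/-- VISIBLE iff some residue over the exact family is `1`. -/
theorem soloBlind_visB_iff (i : B) : soloBlindVisB hli x τ i = true ↔
    ∃ M ∈ soloBlindExactFam h B x τ, soloBlindResid m (soloBlindTyc hli x τ (Sum.inl i)) M = 1 := by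
  constructor
  · intro hv
    unfold soloBlindVisB soloBlindVisible at hv
    rw [Bool.and_eq_true, List.any_eq_true] at hv
    obtain ⟨M, hM, h1⟩ := hv.2
    rw [soloBlind_flatTabs_r1 (soloBlindTyc_lt hli x τ _) (soloBlind_exactFam_lt hM), decide_eq_true_eq] at h1
    exact ⟨M, hM, h1⟩
  · rintro ⟨M, hM, h1⟩
    rcases soloBlind_visible_or_resid_zero hli x τ i with hv | h0
    · exact hv
    · rw [h0 M hM] at h1
      exact absurd h1 (by decide)

/-- VISIBLE iff in the core. -/
theorem soloBlind_visB_iff_mem_core (hxB : ∀ a, x a ∉ B) (i : B) :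
    soloBlindVisB hli x τ i = true ↔ (i : ι) ∈ soloBlindCore h (B ∪ Finset.univ.map x) τ := by
  rw [soloBlind_visB_iff, soloBlind_mem_core_inl_iff hli x hxB τ i]

omit [DecidableEq ι] in
/-- The pattern of a visible block index is one of the checker's patterns. -/
theorem soloBlind_patB_mem {i : B} (hv : soloBlindVisB hli x τ i = true) :
    soloBlindPatB hli x τ i ∈ soloBlindPats (soloBlindMkFlatTabs m) m (soloBlindExactFam h B x τ) := by
  unfold soloBlindPats soloBlindPatB
  rw [List.mem_dedup, List.mem_map]
  refine ⟨_, ?_, rfl⟩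
  unfold soloBlindVisTypes
  rw [List.mem_filter, List.mem_range]
  exact ⟨soloBlindTyc_lt hli x τ _, hv⟩

omit [DecidableEq ι] in
/-- The bits of the pattern are the members with residue `1`. -/
theorem soloBlind_testBit_patB (i : B) (k : ℕ) : (soloBlindPatB hli x τ i).testBit k = true ↔
    k < (soloBlindExactFam h B x τ).length ∧
      soloBlindResid m (soloBlindTyc hli x τ (Sum.inl i)) ((soloBlindExactFam h B x τ).getD k 0) = 1 := by
  unfold soloBlindPatB soloBlindPatOf
  rw [soloBlind_testBit_enc, Finset.mem_filter, Finset.mem_range]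
  constructor
  · rintro ⟨hk, h1⟩
    rw [soloBlind_flatTabs_r1 (soloBlindTyc_lt hli x τ _) (soloBlind_exactFam_lt (soloBlind_getD_mem hk)),
      decide_eq_true_eq] at h1
    exact ⟨hk, h1⟩
  · rintro ⟨hk, h1⟩
    refine ⟨hk, ?_⟩
    rw [soloBlind_flatTabs_r1 (soloBlindTyc_lt hli x τ _) (soloBlind_exactFam_lt (soloBlind_getD_mem hk)),
      decide_eq_true_eq]
    exact h1

omit [DecidableEq ι] in
/-- A visible block index lies in the fibre of some active pattern index. -/
theorem soloBlind_exists_fib {i : B} (hv : soloBlindVisB hli x τ i = true) :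
    ∃ j ∈ soloBlindJAct hli x τ, i ∈ soloBlindPatFib hli x τ j := by
  obtain ⟨j, hj, hjp⟩ := List.mem_iff_getElem.mp (soloBlind_patB_mem hli x τ hv)
  have hfib : i ∈ soloBlindPatFib hli x τ j := by
    unfold soloBlindPatFib
    rw [Finset.mem_filter]
    exact ⟨Finset.mem_univ _, hv, by rw [List.getD_eq_getElem _ _ hj, hjp]⟩
  refine ⟨j, ?_, hfib⟩
  unfold soloBlindJAct soloBlindPatMult
  rw [Finset.mem_filter, Finset.mem_range]
  exact ⟨hj, Finset.card_pos.mpr ⟨i, hfib⟩⟩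

omit [DecidableEq ι] in
/-- Fibres of distinct pattern indices are disjoint. -/
theorem soloBlind_fib_disjoint {j j' : ℕ}
    (hj : j < (soloBlindPats (soloBlindMkFlatTabs m) m (soloBlindExactFam h B x τ)).length)
    (hj' : j' < (soloBlindPats (soloBlindMkFlatTabs m) m (soloBlindExactFam h B x τ)).length) (hne : j ≠ j') :
    Disjoint (soloBlindPatFib hli x τ j) (soloBlindPatFib hli x τ j') := by
  rw [Finset.disjoint_left]
  intro i hi hi'
  unfold soloBlindPatFib at hi hi'
  rw [Finset.mem_filter] at hi hi'
  have heq := hi.2.2.symm.trans hi'.2.2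
  rw [List.getD_eq_getElem _ _ hj, List.getD_eq_getElem _ _ hj'] at heq
  exact hne ((soloBlind_pats_nodup _ m _).getElem_inj_iff.mp heq)

omit [DecidableEq ι] in
/-- Active indices are in range. -/
theorem soloBlind_jAct_lt {j : ℕ} (hj : j ∈ soloBlindJAct hli x τ) :
    j < (soloBlindPats (soloBlindMkFlatTabs m) m (soloBlindExactFam h B x τ)).length := by
  unfold soloBlindJAct at hj
  exact Finset.mem_range.mp (Finset.mem_filter.mp hj).1

/-- THE BLOCK EXPONENTS OF THE PATTERN MODEL UNDERCOUNT: `a_k(J, mult) ≤ #{i : resid(t_i, M_k) = 1}`. -/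
theorem soloBlind_patExp_le (k : ℕ) :
    soloBlindPatExp (soloBlindJAct hli x τ)
        (soloBlindSeesL (soloBlindPats (soloBlindMkFlatTabs m) m (soloBlindExactFam h B x τ)))
        (soloBlindPatMult hli x τ) k ≤
      (Finset.univ.filter fun i : B => soloBlindResid m (soloBlindTyc hli x τ (Sum.inl i))
        ((soloBlindExactFam h B x τ).getD k 0) = 1).card := by
  unfold soloBlindPatExp soloBlindPatMult
  rw [← Finset.card_biUnion]
  · apply Finset.card_le_card
    intro i hi
    rw [Finset.mem_biUnion] at hi
    obtain ⟨j, hj, hij⟩ := hi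
    rw [Finset.mem_filter] at hj ⊢
    refine ⟨Finset.mem_univ _, ?_⟩
    unfold soloBlindPatFib at hij
    rw [Finset.mem_filter] at hij
    have hbit : (soloBlindPatB hli x τ i).testBit k = true := by
      rw [hij.2.2]
      exact hj.2
    exact ((soloBlind_testBit_patB hli x τ i k).mp hbit).2
  · intro j hj j' hj' hne
    rw [Finset.mem_coe, Finset.mem_filter] at hj hj'
    exact soloBlind_fib_disjoint hli x τ (soloBlind_jAct_lt hli x τ hj.1) (soloBlind_jAct_lt hli x τ hj'.1) hne

/-- THE TOTAL MULTIPLICITY IS THE NUMBER OF VISIBLE BLOCK INDICES. -/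
theorem soloBlind_sum_mult : ∑ j ∈ soloBlindJAct hli x τ, soloBlindPatMult hli x τ j =
    (Finset.univ.filter fun i : B => soloBlindVisB hli x τ i = true).card := by
  unfold soloBlindPatMult
  rw [← Finset.card_biUnion]
  · congr 1
    ext i
    rw [Finset.mem_biUnion, Finset.mem_filter]
    constructor
    · rintro ⟨j, -, hij⟩
      unfold soloBlindPatFib at hij
      exact ⟨Finset.mem_univ _, (Finset.mem_filter.mp hij).2.1⟩
    · rintro ⟨-, hv⟩
      exact soloBlind_exists_fib hli x τ hv
  · intro j hj j' hj' hne
    rw [Finset.mem_coe] at hj hj'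
    exact soloBlind_fib_disjoint hli x τ (soloBlind_jAct_lt hli x τ hj) (soloBlind_jAct_lt hli x τ hj') hne

/-- THE VISIBLE BLOCK INDICES ARE THE CORE INSIDE THE BLOCK. -/
theorem soloBlind_card_visB (hxB : ∀ a, x a ∉ B) :
    (Finset.univ.filter fun i : B => soloBlindVisB hli x τ i = true).card =
      (soloBlindCore h (B ∪ Finset.univ.map x) τ ∩ B).card := by
  rw [← Finset.card_map (Function.Embedding.subtype (· ∈ B))]
  congr 1
  ext y
  rw [Finset.mem_map, Finset.mem_inter]
  constructor
  · rintro ⟨i, hi, rfl⟩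
    rw [Finset.mem_filter] at hi
    exact ⟨(soloBlind_visB_iff_mem_core hli x τ hxB i).mp hi.2, i.2⟩
  · rintro ⟨hy, hyB⟩
    refine ⟨⟨y, hyB⟩, Finset.mem_filter.mpr ⟨Finset.mem_univ _, ?_⟩, rfl⟩
    exact (soloBlind_visB_iff_mem_core hli x τ hxB ⟨y, hyB⟩).mpr hy

omit [Module (ZMod 3) G] in
/-- THE CORE SIZE when all letters are used: `|core| = |core ∩ B| + m`. -/
theorem soloBlind_card_core_of_used (hxB : ∀ a, x a ∉ B)
    (hused : ∀ a : Fin m, ∃ M ∈ soloBlindExactFam h B x τ, M.testBit a = true) :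
    (soloBlindCore h (B ∪ Finset.univ.map x) τ).card =
      (soloBlindCore h (B ∪ Finset.univ.map x) τ ∩ B).card + m := by
  have hsplit : soloBlindCore h (B ∪ Finset.univ.map x) τ =
      soloBlindCore h (B ∪ Finset.univ.map x) τ ∩ B ∪ Finset.univ.map x := by
    ext y
    rw [Finset.mem_union, Finset.mem_inter]
    constructor
    · intro hy
      rcases Finset.mem_union.mp (soloBlind_core_subset h _ τ hy) with hyB | hyX
      · exact Or.inl ⟨hy, hyB⟩
      · exact Or.inr hyX
    · rintro (⟨hy, -⟩ | hyX)
      · exact hy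
      · obtain ⟨a, -, rfl⟩ := Finset.mem_map.mp hyX
        obtain ⟨M, hM, ha⟩ := hused a
        exact soloBlind_letter_mem_core x hxB τ hM ha
  conv_lhs => rw [hsplit]
  rw [Finset.card_union_of_disjoint
    (Finset.disjoint_of_subset_left Finset.inter_subset_right (soloBlind_disjoint_map x hxB)),
    Finset.card_map, Finset.card_univ, Fintype.card_fin]

/-- THE MASS IS BOUNDED BY THE PATTERN-MODEL MASS of the active patterns with their multiplicities. -/
theorem soloBlind_mass_le_patMass (hxB : ∀ a, x a ∉ B)
    (hdist : ∀ A ⊆ B, ∀ A' ⊆ B, ∑ i ∈ A, h i = ∑ i ∈ A', h i → A = A') :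
    soloBlindMass h (B ∪ Finset.univ.map x) τ ≤
      soloBlindPatMass (Finset.range ((soloBlindExactFam h B x τ).map fun M => (soloBlindDecSet m M).card).length)
        (soloBlindSzL ((soloBlindExactFam h B x τ).map fun M => (soloBlindDecSet m M).card))
        (soloBlindJAct hli x τ)
        (soloBlindSeesL (soloBlindPats (soloBlindMkFlatTabs m) m (soloBlindExactFam h B x τ)))
        (soloBlindPatMult hli x τ) := by
  set F := soloBlindExactFam h B x τ with hFdef
  -- the true block exponents
  set aM : ℕ → ℕ := fun M => (Finset.univ.filter fun i : B =>
    soloBlindResid m (soloBlindTyc hli x τ (Sum.inl i)) M = 1).card with haM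
  have hnd : F.Nodup := (soloBlind_exactFam_sublist h B x τ).nodup List.nodup_range
  -- step 1: restrict the mask sum to the exact family and bound the block masses
  have step1 : soloBlindMass h (B ∪ Finset.univ.map x) τ ≤
      ∑ M ∈ F.toFinset, (1 / 2 : ℚ) ^ ((soloBlindDecSet m M).card + aM M) := by
    rw [soloBlind_mass_eq_sum_masks h B x hxB τ]
    have hsub : F.toFinset ⊆ Finset.range (2 ^ m) := fun M hM =>
      Finset.mem_range.mpr (soloBlind_exactFam_lt (List.mem_toFinset.mp hM))
    rw [← Finset.sum_subset hsub]
    · refine Finset.sum_le_sum fun M hM => ?_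
      rw [pow_add]
      refine mul_le_mul_of_nonneg_left ?_ (by positivity)
      refine soloBlind_mass_le_pow_of_card_le_one h B _ (aM M)
        (soloBlind_repAll_card_le_one_of_sumDistinct hdist _) fun T hT => ?_
      rw [soloBlind_repAll_card_eq h B hli hT, haM]
      refine (Finset.card_le_card fun i hi => ?_)
      rw [Finset.mem_filter] at hi ⊢
      exact ⟨hi.1, by rw [← soloBlind_resid_tyc]; exact hi.2⟩
    · intro M hM hMF
      have hempty : soloBlindSeqRepAll h B (τ - ∑ a ∈ soloBlindDecSet m M, h (x a)) = ∅ := by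
        rw [← Finset.not_nonempty_iff_eq_empty]
        exact fun hne => hMF (List.mem_toFinset.mpr
          (soloBlind_mem_exactFam.mpr ⟨Finset.mem_range.mp hM, hne⟩))
      rw [soloBlindMass, hempty, Finset.sum_empty, mul_zero]
  -- step 2: reindex by position in the family
  have step2 : ∑ M ∈ F.toFinset, (1 / 2 : ℚ) ^ ((soloBlindDecSet m M).card + aM M) =
      ∑ k ∈ Finset.range F.length, (1 / 2 : ℚ) ^ ((soloBlindDecSet m (F.getD k 0)).card + aM (F.getD k 0)) := by
    symm
    refine Finset.sum_bij (fun k _ => F.getD k 0) (fun k hk => ?_) (fun k hk k' hk' heq => ?_)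
      (fun M hM => ?_) (fun k hk => rfl)
    · exact List.mem_toFinset.mpr (soloBlind_getD_mem (Finset.mem_range.mp hk))
    · have hk2 := Finset.mem_range.mp hk
      have hk'2 := Finset.mem_range.mp hk'
      rw [List.getD_eq_getElem _ _ hk2, List.getD_eq_getElem _ _ hk'2] at heq
      exact hnd.getElem_inj_iff.mp heq
    · obtain ⟨k, hk, hkM⟩ := List.mem_iff_getElem.mp (List.mem_toFinset.mp hM)
      exact ⟨k, Finset.mem_range.mpr hk, by rw [List.getD_eq_getElem _ _ hk, hkM]⟩
  -- step 3: compare exponents termwise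
  refine step1.trans ?_
  rw [step2, List.length_map]
  unfold soloBlindPatMass
  refine Finset.sum_le_sum fun k hk => ?_
  have hk2 := Finset.mem_range.mp hk
  refine pow_le_pow_of_le_one (by norm_num) (by norm_num) ?_
  have hsz : soloBlindSzL (F.map fun M => (soloBlindDecSet m M).card) k = (soloBlindDecSet m (F.getD k 0)).card := by
    unfold soloBlindSzL
    rw [List.getD_eq_getElem _ _ (by rw [List.length_map]; exact hk2), List.getElem_map,
      List.getD_eq_getElem _ _ hk2]
  rw [hsz]
  exact Nat.add_le_add_left (soloBlind_patExp_le hli x τ k) _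

/-- THE ACTIVE SET IS VALID for the checker's killer masks (reference member `C₀ ∈ F`). -/
theorem soloBlind_validSem_jAct (hxB : ∀ a, x a ∉ B) (modeE : Bool)
    (zsf : ∀ T ⊆ B ∪ Finset.univ.map x, T.Nonempty → ∑ i ∈ T, h i ≠ 0)
    (hgood : modeE = true → ∀ T ⊆ B ∪ Finset.univ.map x, ∑ i ∈ T, h i ≠ τ + τ)
    {C₀ : ℕ} (hC₀ : C₀ ∈ soloBlindExactFam h B x τ) :
    soloBlindValidSem
      ((soloBlindNeeds (soloBlindMkFlatTabs m) m (soloBlindExactFam h B x τ) C₀ modeE).map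
        (soloBlindKillerMask (soloBlindMkFlatTabs m) m
          ((soloBlindPats (soloBlindMkFlatTabs m) m (soloBlindExactFam h B x τ)).map
            (soloBlindBucket (soloBlindMkFlatTabs m) m (soloBlindExactFam h B x τ)))))
      (soloBlindJAct hli x τ) := by
  intro km hkm
  rw [List.mem_map] at hkm
  obtain ⟨N, hN, rfl⟩ := hkm
  obtain ⟨i, hv, hkill⟩ := soloBlind_flatNeeds_met hli x hxB τ modeE zsf hgood hC₀ hN
  have hv' : soloBlindVisB hli x τ i = true := hv
  obtain ⟨j, hj, hjp⟩ := List.mem_iff_getElem.mp (soloBlind_patB_mem hli x τ hv')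
  have hfib : i ∈ soloBlindPatFib hli x τ j := by
    unfold soloBlindPatFib
    rw [Finset.mem_filter]
    exact ⟨Finset.mem_univ _, hv', by rw [List.getD_eq_getElem _ _ hj, hjp]⟩
  refine ⟨j, ?_, ?_⟩
  · unfold soloBlindJAct soloBlindPatMult
    rw [Finset.mem_filter, Finset.mem_range]
    exact ⟨hj, Finset.card_pos.mpr ⟨i, hfib⟩⟩
  · unfold soloBlindKillerMask
    rw [soloBlind_testBit_enc, Finset.mem_filter, Finset.mem_range, List.length_map]
    refine ⟨hj, ?_⟩
    rw [List.getD_eq_getElem _ _ (by rw [List.length_map]; exact hj), List.getElem_map, List.any_eq_true]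
    refine ⟨soloBlindTyc hli x τ (Sum.inl i), ?_, hkill⟩
    unfold soloBlindBucket
    rw [List.mem_filter, beq_iff_eq]
    refine ⟨?_, hjp.symm⟩
    unfold soloBlindVisTypes
    rw [List.mem_filter, List.mem_range]
    exact ⟨soloBlindTyc_lt hli x τ _, hv⟩

/-- THE `d`-CERTIFICATE BOUNDS THE CORE RANK: `coreRank + d ≤ |core ∩ B| + m` (reference member `C₀ ∈ F`). -/
theorem soloBlind_coreRank_add_flatD_le (hxB : ∀ a, x a ∉ B) {C₀ : ℕ} (hC₀ : C₀ ∈ soloBlindExactFam h B x τ) :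
    soloBlindCoreRank h (B ∪ Finset.univ.map x) τ +
        soloBlindFlatD (soloBlindMkFlatTabs m) m (soloBlindExactFam h B x τ) C₀ ≤
      (soloBlindCore h (B ∪ Finset.univ.map x) τ ∩ B).card + m := by
  set F := soloBlindExactFam h B x τ with hFdef
  obtain ⟨-, ⟨A₀, hA₀⟩⟩ := soloBlind_mem_exactFam.mp hC₀
  obtain ⟨hT₀, hLP₀⟩ := soloBlind_unionRep_mem x hxB hA₀
  have hrank := soloBlind_coreRank_add_finrank_le h hxB (subset_refl (B ∪ Finset.univ.map x)) τ hT₀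
  rw [Fintype.card_fin] at hrank
  have hD : soloBlindFlatD (soloBlindMkFlatTabs m) m F C₀ ≤ finrank (ZMod 3)
      ↥(soloBlindDiffSpace (ZMod 3)
        ((soloBlindSeqRepAll h (B ∪ Finset.univ.map x) τ).image (soloBlindLetterPart x))
        (soloBlindLetterPart x ((soloBlindDecSet m C₀).map x ∪ A₀))) := by
    refine (soloBlind_flatD_le_finrank (soloBlind_exactFam_lt hC₀) fun M hM => soloBlind_exactFam_lt hM).trans
      (Submodule.finrank_mono ?_)
    unfold soloBlindDiffSpace
    refine Submodule.span_mono ?_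
    rintro v ⟨M, hM, rfl⟩
    obtain ⟨-, ⟨A, hA⟩⟩ := soloBlind_mem_exactFam.mp hM
    obtain ⟨hT, hLP⟩ := soloBlind_unionRep_mem x hxB hA
    refine ⟨soloBlindDecSet m M, ?_, ?_⟩
    · rw [Finset.coe_image]
      exact ⟨_, Finset.mem_coe.mpr hT, hLP⟩
    · rw [hLP₀]
      rfl
  omega

end Model

end Summit.MatrixMultiplication.MatrixMultiplication.Theorems
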